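import Mathlib
import Summits.ValiantsHypothesis.ValiantsHypothesis.Theorems.GeneratorObstructionsPowGenDegreeQPBorelDense
import Summits.ValiantsHypothesis.ValiantsHypothesis.Theorems.GeneratorObstructionsPowGenDegreeQPWideRegime
import Literature.Computability.AlgebraicComplexity.OrbitClosureWeights

/-!
# K2 `PowGenDegreeQP` (stmt-ValiantsHypothesis-11655), line `trace-side-regimes`:
# generator types of a Borel-dense orbit closure with sign symmetries and fundamental even weights
# (the reduction of the row `m = 2` — quadrics — to two classical inputs)

Helper file (`--supports stmt-ValiantsHypothesis-11655`).  The row `m = 2` of the window of K2 concerns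
`Δ_2(tr X_n²) = Sym²(k^{n²})` (a full-rank quadric; its orbit closure is the space of all quadrics,
a SPHERICAL variety).  This file proves the structural half of that row for ANY form `f` of degree
`m` with a Borel-dense orbit point `h₀ · f` (`…PowGenDegreeQPBorelDense`) admitting

* (sign symmetries) for every letter `u` an upper triangular `b` with diagonal `(1,…,-1,…,1)` (`-1`
  at `u`) fixing `h₀ · f` — then every occurring weight is EVEN (`even_apply_of_occurs_of_sign`);
* (fundamental weights) the weights `-2·𝟙_{≥ t}` occur for every letter `t` — then every even,
  antitone, nonpositive weight occurs (`hasHighestWeight_of_even_antitone_nonpos`, peeling off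
  `-2·𝟙_{≥ t₀}` at the least letter of the support, semigroup property);

and concludes: **every generator type is `0` or a fundamental weight `-2·𝟙_{≥ t}`**
(`genType_eq_zero_or_fundamental`), so **`-|χ| ≤ 2·#σ`** (`neg_size_le_of_genType_of_sign_of_fund`),
and the K2-shaped window bound at `m = 2` with exponent `c₀ = c + 1`
(`rowTwo_bound_of_sign_of_fund`).  For `f = tr X_n²` both inputs are classical and TRUE — the
Cholesky density of `B · (∑ x_u²)` (symmetric matrices with nonzero leading minors are `bᵀ b`) with
its diagonal sign stabilisers, and the principal minors of the Gram matrix on final segments as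
highest-weight vectors of weight `-2·𝟙_{≥ t}` — but are NOT typed here: this file is the exact
repair census of the row `m = 2` in Lean form (remaining inputs = the two hypotheses, verbatim).

Honest label: reduction; rows `m ≥ 2` of both registered stubs stay OPEN.
References: Vinberg–Kimel'fel'd 1978 Thm. 1; Goodman–Wallach §5.7 / §12.2.3 (`k[Sym² ℂ^N]^U` is the
polynomial ring on the `N` principal minors, weights `2ω_k`).
-/

namespace Summit.ValiantsHypothesis.ValiantsHypothesis.Theorems.GeneratorObstructions.PowGenDegreeQP

open MvPolynomial
open Literature.NumberTheory.DiophantineGeometry Literature.Computability.AlgebraicComplexity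

-- `Summit.ValiantsHypothesis.ValiantsHypothesis.…` is the tree's mandated single-conjunct layout.
set_option linter.dupNamespace false

noncomputable section

variable {σ k : Type*} [Fintype σ] [LinearOrder σ] [Field k]

/-! ## 1. Sign symmetries force even weights -/

/-- In characteristic zero, `(-1)^z = 1` forces `z` even. [folklore] -/
theorem even_of_neg_one_zpow_eq_one [CharZero k] {z : ℤ} (h : (-1 : k) ^ z = 1) : Even z := by
  rcases Int.even_or_odd z with hz | hz
  · exact hz
  · exfalso
    rw [hz.neg_one_zpow] at h
    have h2 : (2 : k) = 0 := by
      have : (-1 : k) + 1 = 1 + 1 := by rw [h]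
      rw [neg_add_cancel] at this
      rw [show (2 : k) = 1 + 1 by norm_num]
      exact this.symm
    exact two_ne_zero h2

section Structure

variable {f : MvPolynomial σ k} {m : ℕ} {h₀ : GL σ k}

/-- **Sign symmetries at a Borel-dense point make all occurring weights even**: if an upper
triangular `b` with diagonal `-1` at `u` and `1` elsewhere fixes `h₀ · f`, then `χ(b) = (-1)^{χ_u}`
is `1` for every occurring `χ` (`weightChar_eq_one_of_fix_of_dense`). [folklore] -/
theorem even_apply_of_occurs_of_sign [CharZero k]
    (hdense : ∀ x : OrbitCoordRing f m,
      (∀ b : GL σ k, IsUpperTriangular b → evalAtPoint f m (orbitCoordRep f m (b * h₀)⁻¹ x) = 0) →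
        x = 0)
    (hsign : ∀ u : σ, ∃ b : GL σ k, IsUpperTriangular b ∧
      linSubstRep σ k (b * h₀) f = linSubstRep σ k h₀ f ∧
      ∀ i, (b : Matrix σ σ k) i i = if i = u then -1 else 1)
    {χ : Weight σ} (hχ : highestWeightSpace (orbitCoordRep f m) χ ≠ ⊥) (u : σ) : Even (χ u) := by
  obtain ⟨b, hb, hfix, hdiag⟩ := hsign u
  have h1 := weightChar_eq_one_of_fix_of_dense hdense hb hfix hχ
  have h2 : weightChar χ b = (-1 : k) ^ (χ u) := by
    rw [weightChar]
    rw [Finset.prod_eq_single u (fun i _ hi => by rw [hdiag, if_neg hi, one_zpow])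
      (fun h => absurd (Finset.mem_univ u) h), hdiag, if_pos rfl]
  rw [h2] at h1
  exact even_of_neg_one_zpow_eq_one h1

/-! ## 2. Even antitone nonpositive weights are sums of fundamental weights `-2·𝟙_{≥ t}` -/

omit [Fintype σ] in
/-- Peeling identity: `χ = χ' + (-2·𝟙_{≥ t₀})` with `χ' = χ + 2·𝟙_{≥ t₀}`. [folklore] -/
theorem peel_add_fund (χ : Weight σ) (t₀ : σ) :
    (fun v => if t₀ ≤ v then χ v + 2 else χ v) + (fun v => if t₀ ≤ v then (-2 : ℤ) else 0) = χ := by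
  funext v
  simp only [Pi.add_apply]
  split_ifs <;> ring

/-- Size of the peeled weight: `|χ'| = |χ| + 2·#{v ≥ t₀}`. [folklore] -/
theorem size_peel (χ : Weight σ) (t₀ : σ) :
    Weight.size (fun v => if t₀ ≤ v then χ v + 2 else χ v) =
      Weight.size χ + 2 * ((Finset.univ.filter fun v => t₀ ≤ v).card : ℤ) := by
  rw [Weight.size, Weight.size]
  have h : ∀ v, (if t₀ ≤ v then χ v + 2 else χ v) = χ v + (if t₀ ≤ v then (2 : ℤ) else 0) := by
    intro v; split_ifs <;> ring
  simp only [h, Finset.sum_add_distrib, Finset.sum_ite, Finset.sum_const_zero, add_zero,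
    Finset.sum_const, nsmul_eq_mul, mul_comm]

/-- Size of a fundamental weight: `|-2·𝟙_{≥ t}| = -2·#{v ≥ t}`. [folklore] -/
theorem size_fund (t : σ) :
    Weight.size (fun v => if t ≤ v then (-2 : ℤ) else 0) =
      -2 * ((Finset.univ.filter fun v => t ≤ v).card : ℤ) := by
  rw [Weight.size]
  simp only [Finset.sum_ite, Finset.sum_const_zero, add_zero, Finset.sum_const, nsmul_eq_mul,
    mul_comm]

omit [Fintype σ] in
/-- A fundamental weight is nonzero (value `-2` at `t`). [folklore] -/
theorem fund_ne_zero (t : σ) : (fun v => if t ≤ v then (-2 : ℤ) else 0) ≠ (0 : Weight σ) := by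
  intro h
  have := congrFun h t
  simp at this

/-- **Every nonzero even antitone nonpositive weight occurs** in `k[Δ_m f]` as soon as all
fundamental weights `-2·𝟙_{≥ t}` occur (infinite field): peel `-2·𝟙_{≥ t₀}` at the least letter
`t₀` of the support — the rest is again even, antitone, nonpositive and of smaller degree — and use
the semigroup property (`HasHighestWeight.add_of_orbitCoordRep`). [folklore] -/
theorem hasHighestWeight_of_even_antitone_nonpos [Infinite k]
    (hfund : ∀ t : σ, HasHighestWeight (orbitCoordRep f m) (fun v => if t ≤ v then (-2 : ℤ) else 0)) :
    ∀ D : ℕ, ∀ χ : Weight σ, -Weight.size χ ≤ D → (∀ v, χ v ≤ 0) → Antitone χ → (∀ v, Even (χ v)) →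
      χ ≠ 0 → HasHighestWeight (orbitCoordRep f m) χ := by
  intro D
  induction D with
  | zero =>
    intro χ hD hle _ _ hne
    exfalso
    apply hne
    have hsz : Weight.size χ = 0 := by
      have : Weight.size χ ≤ 0 := Finset.sum_nonpos fun v _ => hle v
      push_cast at hD
      omega
    funext v
    have := (Finset.sum_eq_zero_iff_of_nonpos fun v _ => hle v).mp hsz v (Finset.mem_univ v)
    exact this
  | succ D ih =>
    intro χ hD hle hanti heven hne
    classical
    -- least letter of the support
    have hS : (Finset.univ.filter fun v => χ v ≠ 0).Nonempty := by
      by_contra hempty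
      rw [Finset.not_nonempty_iff_eq_empty, Finset.filter_eq_empty_iff] at hempty
      exact hne (funext fun v => not_not.mp (hempty (Finset.mem_univ v)))
    set t₀ := (Finset.univ.filter fun v => χ v ≠ 0).min' hS with ht₀
    have ht₀mem : χ t₀ ≠ 0 := (Finset.mem_filter.mp (Finset.min'_mem _ hS)).2
    have ht₀min : ∀ v, χ v ≠ 0 → t₀ ≤ v := fun v hv =>
      Finset.min'_le _ _ (Finset.mem_filter.mpr ⟨Finset.mem_univ v, hv⟩)
    have hbelow : ∀ v, ¬t₀ ≤ v → χ v = 0 := fun v hv => by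
      by_contra h; exact hv (ht₀min v h)
    have htwo : ∀ v, t₀ ≤ v → χ v ≤ -2 := by
      intro v hv
      have h1 : χ v ≤ χ t₀ := hanti hv
      have h2 : χ t₀ ≤ -2 := by
        obtain ⟨r, hr⟩ := heven t₀
        have := hle t₀
        omega
      omega
    set χ' : Weight σ := fun v => if t₀ ≤ v then χ v + 2 else χ v with hχ'
    have hle' : ∀ v, χ' v ≤ 0 := by
      intro v; simp only [hχ']
      split_ifs with h
      · have := htwo v h; omega
      · exact hle v
    have hanti' : Antitone χ' := by
      intro v w hvw
      simp only [hχ']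
      by_cases hv : t₀ ≤ v
      · rw [if_pos hv, if_pos (hv.trans hvw)]
        have := hanti hvw; omega
      · rw [if_neg hv]
        by_cases hw : t₀ ≤ w
        · rw [if_pos hw, hbelow v hv]
          have := htwo w hw; omega
        · rw [if_neg hw]
          exact hanti hvw
    have heven' : ∀ v, Even (χ' v) := by
      intro v; simp only [hχ']
      split_ifs
      · exact (heven v).add even_two
      · exact heven v
    have hcard : 1 ≤ ((Finset.univ.filter fun v => t₀ ≤ v).card : ℤ) := by
      have : t₀ ∈ (Finset.univ.filter fun v => t₀ ≤ v) :=
        Finset.mem_filter.mpr ⟨Finset.mem_univ _, le_rfl⟩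
      exact_mod_cast Finset.card_pos.mpr ⟨t₀, this⟩
    have hD' : -Weight.size χ' ≤ D := by
      have hsz := size_peel χ t₀
      rw [← hχ'] at hsz
      push_cast at hD ⊢
      omega
    have hsum := peel_add_fund χ t₀
    rw [← hχ'] at hsum
    by_cases hz : χ' = 0
    · rw [hz, zero_add] at hsum
      rw [← hsum]
      exact hfund t₀
    · rw [← hsum]
      exact Literature.NumberTheory.DiophantineGeometry.HasHighestWeight.add_of_orbitCoordRep f m
        (ih χ' hD' hle' hanti' heven' hz) (hfund t₀)

/-! ## 3. Generator types are fundamental weights -/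

/-- **Generator types of a Borel-dense orbit closure with sign symmetries and fundamental even
weights are `0` or fundamental**: if `γ_χ(f) ≠ 0` then `χ = 0` or `χ = -2·𝟙_{≥ t}` for some letter
`t`. (Occurring weights are nonpositive, antitone, even; peel the fundamental weight at the least
letter of the support; a nonzero remainder occurs by §2 and contradicts `atom_of_genType_of_dense`.)
For `f = ∑ x_u²` this is Goodman–Wallach §12.2.3 (`k[Sym²]^U = k[Δ_1,…,Δ_N]`). [folklore] -/
theorem genType_eq_zero_or_fundamental [CharZero k]
    (hdense : ∀ x : OrbitCoordRing f m,
      (∀ b : GL σ k, IsUpperTriangular b → evalAtPoint f m (orbitCoordRep f m (b * h₀)⁻¹ x) = 0) →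
        x = 0)
    (hsign : ∀ u : σ, ∃ b : GL σ k, IsUpperTriangular b ∧
      linSubstRep σ k (b * h₀) f = linSubstRep σ k h₀ f ∧
      ∀ i, (b : Matrix σ σ k) i i = if i = u then -1 else 1)
    (hfund : ∀ t : σ, HasHighestWeight (orbitCoordRep f m) (fun v => if t ≤ v then (-2 : ℤ) else 0))
    {χ : Weight σ}
    (hγ : Module.finrank k (↥(highestWeightSpace (orbitCoordRep f m) χ) ⧸
      Submodule.comap (highestWeightSpace (orbitCoordRep f m) χ).subtype
        (⨆ p : Weight σ × Weight σ, ⨆ (_ : p.1 + p.2 = χ ∧ p.1 ≠ 0 ∧ p.2 ≠ 0),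
          highestWeightSpace (orbitCoordRep f m) p.1 * highestWeightSpace (orbitCoordRep f m) p.2)) ≠
      0) :
    χ = 0 ∨ ∃ t : σ, χ = fun v => if t ≤ v then (-2 : ℤ) else 0 := by
  classical
  haveI : Infinite k := CharZero.infinite k
  have hocc : highestWeightSpace (orbitCoordRep f m) χ ≠ ⊥ := ne_bot_of_finrank_quotient_ne_zero _ _ hγ
  have hocc' : HasHighestWeight (orbitCoordRep f m) χ := hocc
  obtain ⟨hle, -⟩ := nonpos_and_exists_size_eq_of_hasHighestWeight_orbitCoordRep f hocc'
  have hanti : Antitone χ := isDominant_of_hasHighestWeight_orbitCoordRep f hocc'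
  have heven : ∀ v, Even (χ v) := even_apply_of_occurs_of_sign hdense hsign hocc
  by_cases hne : χ = 0
  · exact Or.inl hne
  right
  -- least letter of the support and the peeled weight
  have hS : (Finset.univ.filter fun v => χ v ≠ 0).Nonempty := by
    by_contra hempty
    rw [Finset.not_nonempty_iff_eq_empty, Finset.filter_eq_empty_iff] at hempty
    exact hne (funext fun v => not_not.mp (hempty (Finset.mem_univ v)))
  set t₀ := (Finset.univ.filter fun v => χ v ≠ 0).min' hS with ht₀
  have ht₀min : ∀ v, χ v ≠ 0 → t₀ ≤ v := fun v hv =>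
    Finset.min'_le _ _ (Finset.mem_filter.mpr ⟨Finset.mem_univ v, hv⟩)
  have hbelow : ∀ v, ¬t₀ ≤ v → χ v = 0 := fun v hv => by
    by_contra h; exact hv (ht₀min v h)
  have htwo : ∀ v, t₀ ≤ v → χ v ≤ -2 := by
    intro v hv
    have h1 : χ v ≤ χ t₀ := hanti hv
    have ht₀mem : χ t₀ ≠ 0 := (Finset.mem_filter.mp (Finset.min'_mem _ hS)).2
    have h2 : χ t₀ ≤ -2 := by
      obtain ⟨r, hr⟩ := heven t₀
      have := hle t₀
      omega
    omega
  set χ' : Weight σ := fun v => if t₀ ≤ v then χ v + 2 else χ v with hχ'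
  have hsum := peel_add_fund χ t₀
  rw [← hχ'] at hsum
  refine ⟨t₀, ?_⟩
  by_contra hneq
  have hz : χ' ≠ 0 := by
    intro hz
    apply hneq
    rw [hz, zero_add] at hsum
    exact hsum.symm
  -- the remainder occurs: it is even, antitone, nonpositive and nonzero
  have hle' : ∀ v, χ' v ≤ 0 := by
    intro v; simp only [hχ']
    split_ifs with h
    · have := htwo v h; omega
    · exact hle v
  have hanti' : Antitone χ' := by
    intro v w hvw
    simp only [hχ']
    by_cases hv : t₀ ≤ v
    · rw [if_pos hv, if_pos (hv.trans hvw)]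
      have := hanti hvw; omega
    · rw [if_neg hv]
      by_cases hw : t₀ ≤ w
      · rw [if_pos hw, hbelow v hv]
        have := htwo w hw; omega
      · rw [if_neg hw]
        exact hanti hvw
  have heven' : ∀ v, Even (χ' v) := by
    intro v; simp only [hχ']
    split_ifs
    · exact (heven v).add even_two
    · exact heven v
  have hocc1 : HasHighestWeight (orbitCoordRep f m) χ' :=
    hasHighestWeight_of_even_antitone_nonpos hfund (-Weight.size χ').toNat χ'
      (Int.self_le_toNat _) hle' hanti' heven' hz
  have hocc2 := hfund t₀
  have hatom := atom_of_genType_of_dense hdense hγ χ' _ hsum hz (fund_ne_zero t₀)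
  rcases hatom with h | h
  · exact hocc1 h
  · exact hocc2 h

/-- **Degree bound**: under the same hypotheses every generator type has `-|χ| ≤ 2·#σ`. [folklore] -/
theorem neg_size_le_of_genType_of_sign_of_fund [CharZero k]
    (hdense : ∀ x : OrbitCoordRing f m,
      (∀ b : GL σ k, IsUpperTriangular b → evalAtPoint f m (orbitCoordRep f m (b * h₀)⁻¹ x) = 0) →
        x = 0)
    (hsign : ∀ u : σ, ∃ b : GL σ k, IsUpperTriangular b ∧
      linSubstRep σ k (b * h₀) f = linSubstRep σ k h₀ f ∧
      ∀ i, (b : Matrix σ σ k) i i = if i = u then -1 else 1)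
    (hfund : ∀ t : σ, HasHighestWeight (orbitCoordRep f m) (fun v => if t ≤ v then (-2 : ℤ) else 0))
    {χ : Weight σ}
    (hγ : Module.finrank k (↥(highestWeightSpace (orbitCoordRep f m) χ) ⧸
      Submodule.comap (highestWeightSpace (orbitCoordRep f m) χ).subtype
        (⨆ p : Weight σ × Weight σ, ⨆ (_ : p.1 + p.2 = χ ∧ p.1 ≠ 0 ∧ p.2 ≠ 0),
          highestWeightSpace (orbitCoordRep f m) p.1 * highestWeightSpace (orbitCoordRep f m) p.2)) ≠
      0) :
    -Weight.size χ ≤ 2 * (Fintype.card σ : ℤ) := by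
  classical
  rcases genType_eq_zero_or_fundamental hdense hsign hfund hγ with h | ⟨t, h⟩
  · rw [h]
    simp [Weight.size]
  · rw [h, size_fund, neg_mul, neg_neg]
    have : ((Finset.univ.filter fun v => t ≤ v).card : ℤ) ≤ Fintype.card σ := by
      exact_mod_cast Finset.card_le_univ _
    linarith

end Structure

/-! ## 4. The K2-shaped bound of the row `m = 2` -/

/-- Window arithmetic for the row `m = 2`: if `n ≤ 2^((log₂ 2 + c)^c)` then
`2 n² ≤ 2 · 2^((log₂ 2 + (c+1))^(c+1))`. [folklore] -/
theorem rowTwo_window_bound (c n : ℕ) (hn : n ≤ 2 ^ ((Nat.log 2 2 + c) ^ c)) :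
    2 * ((n * n : ℕ) : ℤ) ≤ ((2 : ℕ) : ℤ) * 2 ^ ((Nat.log 2 2 + (c + 1)) ^ (c + 1)) := by
  have hlog : Nat.log 2 2 = 1 := by norm_num
  rw [hlog] at hn ⊢
  have h1 : n * n ≤ 2 ^ (2 * (1 + c) ^ c) := by
    calc n * n ≤ 2 ^ ((1 + c) ^ c) * 2 ^ ((1 + c) ^ c) := Nat.mul_le_mul hn hn
      _ = 2 ^ (2 * (1 + c) ^ c) := by rw [← pow_add]; ring_nf
  have h2 : 2 * (1 + c) ^ c ≤ (1 + (c + 1)) ^ (c + 1) := by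
    rw [pow_succ, mul_comm]
    apply Nat.mul_le_mul _ (by omega)
    exact Nat.pow_le_pow_left (by omega) c
  have h3 : n * n ≤ 2 ^ ((1 + (c + 1)) ^ (c + 1)) := h1.trans (Nat.pow_le_pow_right (by norm_num) h2)
  have h4 : ((n * n : ℕ) : ℤ) ≤ ((2 ^ ((1 + (c + 1)) ^ (c + 1)) : ℕ) : ℤ) := by exact_mod_cast h3
  push_cast at h4 ⊢
  linarith

/-- **Row `m = 2` of K2, modulo the two classical inputs** (Borel density with sign symmetries
of `tr X_n²` at some `h₀`; occurrence of the fundamental weights `-2·𝟙_{≥ t}`): inside the window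
`n = 2 + e ≤ 2^((log₂ 2 + c)^c)` every generator type of `A(Δ_2(tr X_n²))` satisfies the K2 bound with
exponent `c₀ = c + 1`. The conclusion is the body of `PowGenDegreeQP` at `m = 2`. [folklore] -/
theorem rowTwo_bound_of_sign_of_fund (c e : ℕ) (h₀ : GL (MatIdx (2 + e)) ℂ)
    (hdense : ∀ x : OrbitCoordRing (powFormLex ℂ (2 + e) 2) 2,
      (∀ b : GL (MatIdx (2 + e)) ℂ, IsUpperTriangular b →
        evalAtPoint (powFormLex ℂ (2 + e) 2) 2
          (orbitCoordRep (powFormLex ℂ (2 + e) 2) 2 (b * h₀)⁻¹ x) = 0) → x = 0)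
    (hsign : ∀ u : MatIdx (2 + e), ∃ b : GL (MatIdx (2 + e)) ℂ, IsUpperTriangular b ∧
      linSubstRep (MatIdx (2 + e)) ℂ (b * h₀) (powFormLex ℂ (2 + e) 2) =
        linSubstRep (MatIdx (2 + e)) ℂ h₀ (powFormLex ℂ (2 + e) 2) ∧
      ∀ i, (b : Matrix (MatIdx (2 + e)) (MatIdx (2 + e)) ℂ) i i = if i = u then -1 else 1)
    (hfund : ∀ t : MatIdx (2 + e), HasHighestWeight (orbitCoordRep (powFormLex ℂ (2 + e) 2) 2)
      (fun v => if t ≤ v then (-2 : ℤ) else 0))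
    (hwin : 2 + e ≤ 2 ^ ((Nat.log 2 2 + c) ^ c)) (χ : Weight (MatIdx (2 + e)))
    (hγ : Module.finrank ℂ
      (↥(highestWeightSpace (orbitCoordRep (powFormLex ℂ (2 + e) 2) 2) χ) ⧸
        Submodule.comap (highestWeightSpace (orbitCoordRep (powFormLex ℂ (2 + e) 2) 2) χ).subtype
          (⨆ p : Weight (MatIdx (2 + e)) × Weight (MatIdx (2 + e)),
            ⨆ (_ : p.1 + p.2 = χ ∧ p.1 ≠ 0 ∧ p.2 ≠ 0),
              highestWeightSpace (orbitCoordRep (powFormLex ℂ (2 + e) 2) 2) p.1 *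
                highestWeightSpace (orbitCoordRep (powFormLex ℂ (2 + e) 2) 2) p.2)) ≠ 0) :
    -(Weight.size χ) ≤ ((2 : ℕ) : ℤ) * 2 ^ ((Nat.log 2 2 + (c + 1)) ^ (c + 1)) := by
  have h1 := neg_size_le_of_genType_of_sign_of_fund hdense hsign hfund hγ
  have hcard : Fintype.card (MatIdx (2 + e)) = (2 + e) * (2 + e) := by
    rw [Fintype.card_lex, Fintype.card_prod, Fintype.card_fin]
  rw [hcard] at h1
  exact h1.trans (rowTwo_window_bound c (2 + e) hwin)

end

end Summit.ValiantsHypothesis.ValiantsHypothesis.Theorems.GeneratorObstructions.PowGenDegreeQP
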